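import Summits.KontsevichZagierPeriods.KontsevichZagierPeriods.Theses.ComplexOrientations
import Literature.AlgebraicGeometry.RealAlgebraic.ComplexOrientationFormula
import Literature.Topology.CompactHull
import HarnessLib

/-!
# Route ComplexOrientations — `ComplexOrientationIdentity` (values) from Rokhlin's complex
# orientation formula in integrated form

Item `stmt-KontsevichZagierPeriods-11371` (support, VALUES): for `p ∈ ℚ[x,y]` with compact real
zero locus, nonsingular complex affine curve, geometrically irreducible and DIVIDING, with ovals
`O_i` (connected components of the real locus) and integrand-`1` representations `s_i` over their
interiors `R_i`, there are unit signs `η_i` and a real algebraic `β ≥ 0` with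
`Σ η_i · Area(R_i) = β · π`.

Mathematically this is Rokhlin's complex orientation read through Stokes: the real locus `ℝA`,
with the complex orientation induced from a half `H` of `A ∖ ℝA`, bounds the closure of `H` in the
normalisation `Ã` of the projective closure; `x dy` is holomorphic on the affine curve, so
`∫_{∂H̄} x dy = 2πi · Σ_{P ∈ S ∩ H̄} Res_P (x dy)` (`S` = places at infinity, all non-real and
`ℚ̄`-rational, residues in `ℚ̄`), while by Green `∮_{O_i} x dy = ± Area(R_i)` with the sign
comparing the complex orientation of `O_i` with the counter-clockwise one — the tree's
`Literature.AlgebraicGeometry.RealAlgebraic.complexOrientationSign p H O_i`.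

Neither Stokes on the bordered half nor residues on the normalisation are in reach of the tree, so
the two classical inputs are the NAMED FACTS of
`Literature/AlgebraicGeometry/RealAlgebraic/ComplexOrientationFormula.lean`
(`complexOrientationSign_isUnit_of_isDividing` — Rokhlin 1974: the sign is `±1` on every oval of a
nonsingular dividing curve; `rokhlin_sum_sign_mul_area_ovalInterior_mem_algebraic_mul_pi` — the
integrated complex orientation formula `Σ_O sign(H, O) · Area(ovalInterior O) ∈ (ℚ̄ ∩ ℝ) · π`),
and this file PROVES the item from them (`complexOrientationIdentity_of_rokhlin`): take any half
`H`, `η_i := complexOrientationSign p H (O i)`, identify the value of the integrand-`1`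
representation `s i` with the Lebesgue area of `ovalInterior (O i)`, the finite sum over the SET of
ovals with the `Fin k`-sum over the injective covering enumeration `O`, and flip all signs if the
algebraic factor is negative. Unconditional companions: the conic slice
(`…ComplexOrientationIdentityConics`, `…ConicsFact`) and the numerical test attached to the item.

## References

* [Rokhlin1974] V. A. Rokhlin, Complex orientations of real algebraic curves, Funct. Anal. Appl.
  8 (1974) 331–334, §§2–3.
* [DegtyarevKharlamov2000] A. Degtyarev, V. Kharlamov, Topological properties of real algebraic
  varieties: du côté de chez Rokhlin, Russian Math. Surveys 55 (2000), §1.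
* [HaggShapiro2026] Ch. Hagg, B. Shapiro, Algebraicity of exterior Cauchy transforms of algebraic
  ovals: a homological formulation, arXiv:2606.06296, Thm. 4.1, §5 and Cor. 5.5, eq. (1.2).
-/

noncomputable section

open MvPolynomial Set MeasureTheory
open Literature.AlgebraicGeometry.RealAlgebraic

namespace Summit.KontsevichZagierPeriods.ComplexOrientations

/-- The interior of a closed planar set `O` (the union of the bounded components of `Oᶜ`) is open:
it is a union of connected components of the open set `Oᶜ` of the locally connected plane.
[folklore] -/
theorem isOpen_ovalInterior {O : Set (Fin 2 → ℝ)} (hO : IsClosed O) : IsOpen (ovalInterior O) := by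
  rw [isOpen_iff_mem_nhds]
  intro u hu
  rw [mem_ovalInterior_iff] at hu
  have hopen : IsOpen (connectedComponentIn Oᶜ u) := hO.isOpen_compl.connectedComponentIn
  refine Filter.mem_of_superset (hopen.mem_nhds (mem_connectedComponentIn hu.1)) ?_
  intro u' hu'
  rw [mem_ovalInterior_iff]
  refine ⟨connectedComponentIn_subset _ _ hu', ?_⟩
  rw [← connectedComponentIn_eq hu']
  exact hu.2


/-- The value of an integrand-`1` representation is the Lebesgue area of its domain, for the
interior of a closed planar set. [folklore] -/
theorem value_eq_volume_ovalInterior {O : Set (Fin 2 → ℝ)} (hO : IsClosed O)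
    (s : Literature.NumberTheory.Transcendental.KZ.IntegralRep 2) (hdom : s.domain = ovalInterior O)
    (hone : ∀ v ∈ s.domain, s.integrand v = 1) :
    s.value = (volume (ovalInterior O)).toReal := by
  unfold Literature.NumberTheory.Transcendental.KZ.IntegralRep.value
  rw [hdom] at hone ⊢
  rw [setIntegral_congr_fun (isOpen_ovalInterior hO).measurableSet (fun v hv => hone v hv),
    setIntegral_const, smul_eq_mul, mul_one, Measure.real]

/-- The set of ovals of the real locus is the range of any injective covering enumeration of
components (the route's data `O : Fin k → Set ℝ²`). [folklore] -/
theorem setOf_ovals_eq_range {p : MvPolynomial (Fin 2) ℚ} {k : ℕ} {O : Fin k → Set (Fin 2 → ℝ)}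
    (hO : ∀ i, ∃ v : Fin 2 → ℝ, aeval v p = 0 ∧
      O i = connectedComponentIn {u : Fin 2 → ℝ | aeval u p = 0} v)
    (hcov : ∀ v : Fin 2 → ℝ, aeval v p = 0 → ∃ i, v ∈ O i) :
    {O' : Set (Fin 2 → ℝ) | ∃ v : Fin 2 → ℝ, aeval v p = 0 ∧
        O' = connectedComponentIn {u : Fin 2 → ℝ | aeval u p = 0} v} = Set.range O := by
  ext O'
  simp only [mem_setOf_eq, mem_range]
  constructor
  · rintro ⟨v, hv, rfl⟩
    obtain ⟨i, hi⟩ := hcov v hv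
    obtain ⟨v', hv', hOi⟩ := hO i
    refine ⟨i, ?_⟩
    rw [hOi] at hi ⊢
    exact connectedComponentIn_eq hi
  · rintro ⟨i, rfl⟩
    exact hO i

/-- **`ComplexOrientationIdentity` from Rokhlin's complex orientations** (item
stmt-KontsevichZagierPeriods-11371, CONDITIONAL on the two named facts above): take any half `H`
of the dividing curve, `η_i :=` the complex orientation sign of the oval `O i` relative to `H`
(a unit by `complexOrientationSign_isUnit_of_isDividing`), identify the value of `s i` with
`Area(ovalInterior (O i))` and the sum over the set of ovals with the `Fin k`-sum over the
enumeration `O`, and flip all signs if the algebraic factor `β` is negative.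
[cite: Rokhlin1974, §§2–3] -/
theorem complexOrientationIdentity_of_rokhlin
    (hsign : complexOrientationSign_isUnit_of_isDividing)
    (hrok : rokhlin_sum_sign_mul_area_ovalInterior_mem_algebraic_mul_pi) :
    KontsevichZagierPeriods.Theses.ComplexOrientations.ComplexOrientationIdentity := by
  intro p hcpt hsm hirr hdiv k O s hO hinj hcov hdom hone
  have hdiv' : IsDividing p := hdiv
  have hsm' : ∀ w ∈ complexZeroLocus p, ∃ i, aeval w (pderiv i p) ≠ 0 := fun w hw => hsm w hw
  obtain ⟨H, -, hH, -, -⟩ := isDividing_iff_exists_isHalf_ne.1 hdiv'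
  obtain ⟨β, hβ, hsum⟩ := hrok p hcpt hsm' hirr hdiv' H hH
  rw [setOf_ovals_eq_range hO hcov, finsum_mem_range hinj, finsum_eq_sum_of_fintype] at hsum
  -- the real locus is closed, hence so is each oval
  have hZ : IsClosed {u : Fin 2 → ℝ | aeval u p = 0} := hcpt.isClosed
  have hOc : ∀ i, IsClosed (O i) := fun i => by
    obtain ⟨v, -, hOi⟩ := hO i
    rw [hOi]
    exact Literature.Topology.isClosed_connectedComponentIn_of_closure_subset
      (closure_minimal (connectedComponentIn_subset _ _) hZ)
  have hval : ∀ i, (s i).value = (volume (ovalInterior (O i))).toReal := fun i =>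
    value_eq_volume_ovalInterior (hOc i) (s i) (hdom i) (hone i)
  have hε : ∀ i, complexOrientationSign p H (O i) = 1 ∨ complexOrientationSign p H (O i) = -1 :=
    fun i => by
      obtain ⟨v, hv, hOi⟩ := hO i
      rw [hOi]
      exact hsign p hcpt hsm' hirr hdiv' H hH v hv
  rcases le_or_gt 0 β with hβ0 | hβ0
  · refine ⟨fun i => complexOrientationSign p H (O i), β, hε, hβ, hβ0, ?_⟩
    simpa only [hval] using hsum
  · refine ⟨fun i => -complexOrientationSign p H (O i), -β, fun i => ?_, hβ.neg, by linarith, ?_⟩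
    · rcases hε i with h | h <;> simp [h]
    · have : ∑ i, ((-complexOrientationSign p H (O i) : ℤ) : ℝ) * (s i).value =
          -∑ i, (complexOrientationSign p H (O i) : ℝ) * (volume (ovalInterior (O i))).toReal := by
        rw [← Finset.sum_neg_distrib]
        refine Finset.sum_congr rfl fun i _ => ?_
        rw [hval, Int.cast_neg, neg_mul]
      rw [this, hsum, neg_mul]

end Summit.KontsevichZagierPeriods.ComplexOrientations
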